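import Mathlib.Algebra.BigOperators.Fin
import Literature.Computability.AlgebraicComplexity.Elusive
import Literature.Computability.AlgebraicComplexity.RazExplicit
import Literature.Computability.AlgebraicComplexity.RazElusive
import HarnessLib

/-!
# Raz's elusive-maps criterion for the permanent — general explicit maps and curves

Grounder-style file (D-0014) for cite item `wi-03850` (route ValiantsHypothesis/Elusive), the
GENERAL form of `raz_elusive_momentCurve` (`RazElusive.lean`, the Sidon moment curve instance),
over the tree's `IsElusive` (`Elusive.lean`, Raz Def. 1.1) and Raz's own explicitness notion
`IsPolyDefinableMap` (`RazExplicit.lean`, Raz Def. 1.3).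

**Raz 2010 (Theory of Computing 6, 135–177), abstract:** "Any explicit `f : ℂ → ℂ^m` [whose
image is not contained in the image of any polynomial mapping `Γ : ℂ^{m-1} → ℂ^m` of degree `2`,
i.e. `(m-1, 2)`-elusive] (with the right notion of explicitness), of degree up to `2^{m^{o(1)}}`,
implies super-polynomial lower bounds for computing the permanent over `ℂ`."

## Contents

* `raz_elusive_curve` — the ORIGINAL rendering, which indexes Def. 1.3 by the arity `m`; this is
  MISSTATED (its explicitness clause is void, see the `## Correction` note and
  `RazElusiveGeneralProofs.lean`) and is not Raz's theorem. **DEPRECATED** since the verdict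
  clean-up of 2026-08-15 (`@[deprecated Raz2010_elusive_curve]`, see `## Deprecation` below); it
  is kept verbatim, at the end of the file, only because the theorems certifying the misstatement
  (`raz_elusive_curve_iff`, `raz_elusive_curve_iff_not_isVPFamily`,
  `raz_elusive_curve_iff_perNotPComputableComplex`, downstream) name it.
* `Raz2010_cor_5_8`, `Raz2010_cor_3_9` — the printed theorems behind the abstract (Cor. 5.8 =
  Cor. 1.14, maps eluding degree-`2` maps; Cor. 3.9 = Cor. 1.6, maps eluding degree-`(2r-1)`
  maps), verbatim, as named facts (nothing asserted).
* `Raz2010_result_1` — §1, result 1 (p. 136), the general-`m` form ("`n^{ω(1)} ≤ m`,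
  `s ≥ m^{0.9}`"), verbatim, as a named fact (nothing asserted).
* `multilinearize` — the multilinearisation `f ↦ f̂` of a univariate polynomial (§1.4), with
  Prop. 1.2 PROVED (`eval_multilinearize`, `range_polyMapEval_subset_multilinearize`,
  `IsElusive.multilinearize`).
* `Raz2010_elusive_curve` — the CORRECTED curve statement (explicitness parameter `n = m^{o(1)}`
  carried by the multilinearised curve, as on pp. 136–137), PROVED from `Raz2010_result_1`
  (`Raz2010_elusive_curve_of_result_1`), with the `ℂ`/`VP` corollary
  `Raz2010_elusive_curve.not_isVPFamily_complex`.

The counting fact "generic maps are elusive" (Raz, p. 137) and the machinery of the proofs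
(universal circuit-graphs, Props. 2.7–2.9, 5.3; the polynomial `f̃`, §5.3; Valiant's
`VNP`-completeness of the permanent) are not vendored here.

## Deprecation of `raz_elusive_curve` (verdict clean-up, 2026-08-15)

The tenured prove-seat of the named fact `raz_elusive_curve` returned the verdict *misstated*,
re-verified here against the source and the tree. SOURCE: Raz 2010, Def. 1.3 (p. 142) makes a
polynomial mapping `f : Fⁿ → F^m` "poly(`n`)-definable" through ONE polynomial `g` of degree and
circuit size poly(`n`), and the remark following it (p. 142) reads: "we allow the size of the
arithmetic circuit for `g` to depend polynomially on `n`, but we do not allow it to depend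
polynomially on `m`. This is important because we will consider cases where `m` is
super-polynomial in `n`"; the abstract (p. 135) asks for "any explicit `f` [a curve `ℂ → ℂ^m`
eluding all degree-`2` maps `ℂ^{m-1} → ℂ^m`] (with the right notion of explicitness), of degree
up to `2^{m^{o(1)}}`", and §1 (p. 136: "here, and below, explicit means poly(`n`)-definable, as
defined in Definition 1.3"; result 1: `n^{ω(1)} ≤ m`, `s ≥ m^{0.9}`) fixes the explicitness
parameter as `n = m^{o(1)}`. TREE: `raz_elusive_curve` instantiates the tree's faithful
`IsPolyDefinableMap` (`RazExplicit.lean`) at `(m := id) (σ := fun _ => Fin 1)`, i.e. with family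
index = arity `m`, so its bounds are poly(`m`) — exactly what the remark excludes; accordingly
`raz_elusive_curve_iff` (`RazElusiveGeneralProofs.lean`) proves the explicitness clause void,
and `raz_elusive_curve_iff_not_isVPFamily` / `raz_elusive_curve_iff_perNotPComputableComplex`
(`RazElusiveGeneralExistence.lean`, p15281/p15637) prove
`raz_elusive_curve ↔ ¬ IsVPFamily (PER_ℂ) ↔ PerNotPComputableComplex`, the registered OPEN
statement pnp.S04 of `ValiantConjecture.lean` (Valiant's hypothesis for the permanent over
`ℂ`). Hence the `Prop` is not a theorem of Raz (nor of anyone) and can be neither discharged nor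
refuted short of settling Valiant's hypothesis. TREATMENT (human ruling 2026-08-15: restate, do
not delete): the correction is NOT meaning-preserving (other indexation, other type), so the
corrected statement lives under the new name `Raz2010_elusive_curve` (this file; proved from
§1 result 1 by `Raz2010_elusive_curve_of_result_1`, and DISCHARGED outright as
`Raz2010_elusive_curve_holds` in `RazElusiveGeneralDischarge.lean`), and the old `def` is kept
byte-for-byte under `@[deprecated Raz2010_elusive_curve]` in the final section of this file.
Its unused shape-of-use lemma `not_isVPFamily_perPoly_of_elusive (h : raz_elusive_curve) … :
¬ IsVPFamily (PER_ℂ)` (the `def` restated as an implication; no user in the tree) is DELETED —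
the faithful shape-of-use lemma is `Raz2010_elusive_curve.not_isVPFamily_complex`. No summit
file uses either name.

## References

* R. Raz, *Elusive functions and lower bounds for arithmetic circuits*, Theory of Computing 6
  (2010) 135–177: abstract; §1 (results 1–2, p. 136; p. 137); §1.4 (Def. 1.1, Prop. 1.2); §1.5
  (Def. 1.3 and the remark following it, p. 142); Cor. 1.6 = Cor. 3.9 (pp. 145, 163); Cor. 1.14 =
  Cor. 5.8 (pp. 147, 172).
-/

noncomputable section

open MvPolynomial

namespace Literature.Computability.AlgebraicComplexity

universe u

/-!
## Correction (2026-08-14): what Raz 2010 actually proves, and why `raz_elusive_curve` is not it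

`raz_elusive_curve` indexes Raz's poly(`n`)-definability (Def. 1.3) by the OUTPUT ARITY `m`
(`IsPolyDefinableMap (m := id)`): the defining polynomial `g_m` may have `poly(m)` size and
degree. But then the explicitness clause is implied by the degree clause: for any curve family
with `deg (f m i) ≤ poly(m)` take `ℓ = 0` and
`g_m = Σ_{i<m} f_{m,i}(x) · Π_{t<k} (w_t if bit_t(i) = 1 else 1 - w_t)` (`k = ⌈log₂ m⌉`), of
degree `≤ poly(m) + k` and circuit size `O(m · (poly(m)² + k))`; this is proved in
`RazElusiveGeneralProofs.lean` (`isPolyDefinableMap_id_of_isPBounded_totalDegree`,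
`raz_elusive_curve_iff`). Hence `raz_elusive_curve` says "if SOME polynomial-degree curve family
is eventually `(m-1, 2)`-elusive then `PER ∉ VP_ℂ`", with no explicitness content; since such
families exist non-explicitly (generic curves of degree `≥ m³` are `(m-1, 2)`-elusive, by
interpolation at `D + 1` points and a dimension count; cf. Raz 2010, p. 137, printed for the
settings `Fⁿ → F^m` of the paper: "it is not hard to show the existence of (non-explicit)
polynomial mappings with the required properties"), it is equivalent to Valiant's hypothesis
for the permanent and is not a theorem in print.

Raz is explicit that this is the crux (p. 142, after Def. 1.3): "we allow the size of the
arithmetic circuit for `g` to depend polynomially on `n`, but we do not allow it to depend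
polynomially on `m`. This is important because we will consider cases where `m` is
super-polynomial in `n`." The printed theorems behind the abstract's curve sentence are
Cor. 1.14 = Cor. 5.8 (maps eluding degree-`2` maps) and Cor. 1.6 = Cor. 3.9 (maps eluding
degree-`(2r-1)` maps), both for families indexed by Raz's basic parameter `n` = number of
variables = explicitness parameter, with `m = m(n)` of binomial shape and super-polynomial growth
conditions; the abstract's curve `ℂ → ℂ^m` of degree `≤ 2^{m^{o(1)}}` enters through the
multilinearisation of Prop. 1.2 (`n = m^{o(1)}` new variables) and intro result 1 (p. 136:
`n^{ω(1)} ≤ m`, `s ≥ m^{0.9}`), i.e. "explicit" there means that the multilinearised curve is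
poly(`n`)-definable with `n = m^{o(1)}`, not poly(`m`).

Below, the two printed corollaries and §1 result 1 (the general-`m` form of Cor. 1.14 stated
on p. 136) are vendored verbatim as named facts (nothing asserted), the multilinearisation of
Prop. 1.2 is defined and Prop. 1.2 proved, and the abstract's curve statement is then stated
with Raz's explicitness (`Raz2010_elusive_curve`) and PROVED from result 1.
Rendering choices, each weaker than or equal to print: all parameters are functions of `n` and
the side conditions `3 ≤ r ≤ n ≤ s` (resp. `1 ≤ r ≤ n ≤ s`) are asked for all large `n`
(they are unsatisfiable at `n < 3`, and the proofs are asymptotic); "`≥ n^{ω(1)}`" is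
`∀ c, eventually n^c · (…) ≤ s n`; "over some field extension `G ⊇ F`" is an extension field
`G` (same universe) chosen for each large `n`, the coordinates being mapped along
`algebraMap F G` (Raz, §1.4: `F[x] ⊂ G[x]`); the conclusion "any arithmetic circuit for the
permanent over `F` is of size `≥ (s / (C(n+r'-1, r') · r³))^{Ω(1)}`" (Cor. 5.8), resp.
"`≥ s^{Ω(1)}`" (Cor. 3.9), whose unprinted `Ω(1)` comes from Valiant's completeness reduction,
is recorded by its content in the stated regime, "of super-polynomial size" (intro, p. 136):
`¬ IsPComputable (fun N => perPoly (Fin N) F)` (which gives `¬ IsVPFamily` a fortiori).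
-/

section NamedFacts

/-! The three printed statements are named facts (nothing asserted); the field `F` is a section
variable so that each is a closed `def … : Prop` for the tree's named-fact index. -/

variable (F : Type u) [Field F]

/-- **Raz 2010, Corollary 5.8 (= Cor. 1.14)**, verbatim: "Let `F` be a field of characteristic
not equal to `2`. Let `3 ≤ r ≤ n ≤ s`, and `m = C(n+r-1, r)` be integers. Let `r' = ⌊2r/3⌋`.
Assume that `s / C(n+r'-1, r') ≥ n^{ω(1)}`. If there exists a poly(`n`)-definable polynomial
mapping `f : Fⁿ → F^m` such that, over some field extension `G ⊇ F`, `f` is `(s, 2)`-elusive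
(see Definition 1.3 and Definition 1.1), then any arithmetic circuit for the permanent over `F`
is of size `≥ (s / (C(n+r'-1, r') · r³))^{Ω(1)}`." Here `r s : ℕ → ℕ` are Raz's parameters as
functions of the basic parameter `n` (p. 147), `f n : Fin (C(n + r n - 1, r n)) → F[x₁…xₙ]`,
explicitness is `IsPolyDefinableMap` (Def. 1.3, bounds polynomial in `n`, NOT in `m`),
elusiveness is `IsElusive … (s n) 2` of the coordinates mapped to `G`, and the conclusion is
rendered as "the permanent family over `F` is not p-computable" (see the `## Correction` module
note for the rendering choices; junk values of `n + 2 * r n / 3 - 1` at small `n` are never used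
since every side condition is eventual). Users take `(h : Raz2010_cor_5_8 F)`.
[cite: Raz2010, Cor. 5.8 (p. 172) = Cor. 1.14 (p. 147); Defs. 1.1, 1.3] -/
def Raz2010_cor_5_8 : Prop :=
  ringChar F ≠ 2 →
    ∀ (r s : ℕ → ℕ) (f : ∀ n : ℕ, Fin (Nat.choose (n + r n - 1) (r n)) → MvPolynomial (Fin n) F),
      (∃ n₀ : ℕ, ∀ n ≥ n₀, 3 ≤ r n ∧ r n ≤ n ∧ n ≤ s n) →
        (∀ c : ℕ, ∃ n₀ : ℕ, ∀ n ≥ n₀,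
            n ^ c * Nat.choose (n + 2 * r n / 3 - 1) (2 * r n / 3) ≤ s n) →
          IsPolyDefinableMap (m := fun n => Nat.choose (n + r n - 1) (r n)) (σ := fun n => Fin n)
              f →
            (∃ n₀ : ℕ, ∀ n ≥ n₀, ∃ (G : Type u) (_ : Field G) (_ : Algebra F G),
                IsElusive (fun i => MvPolynomial.map (algebraMap F G) (f n i)) (s n) 2) →
              ¬ IsPComputable (fun N => perPoly (Fin N) F)

/-- **Raz 2010, Corollary 3.9 (= Cor. 1.6)**, verbatim: "Let `F` be a field of characteristic
not equal to `2`. Let `1 ≤ r ≤ n ≤ s`, and `m = n · C(n+r-1, r)` be integers such that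
`s = n^{ω(1)}`. If there exists a poly(`n`)-definable polynomial mapping `f : Fⁿ → F^m` such
that, over some field extension `G ⊇ F`, `f` is `(s, (2r-1))`-elusive (see Definition 1.3 and
Definition 1.1), then any arithmetic circuit for the permanent over `F` is of size `≥ s^{Ω(1)}`."
Same rendering as `Raz2010_cor_5_8`: parameters `r s : ℕ → ℕ` as functions of `n`, side
conditions for all large `n`, `s = n^{ω(1)}` as `∀ c, eventually n^c ≤ s n`, extension field per
large `n`, conclusion "the permanent family over `F` is not p-computable" (intro result 2,
p. 136: "of super-polynomial size"). The range `1 ≤ r` is that of Cor. 3.9 (p. 162: "these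
corollaries are only interesting for `r ≥ 2` (although, to avoid confusion, they are stated for
`r ≥ 1`)"; the introduction's copy, Cor. 1.6, prints `2 ≤ r`). Users take
`(h : Raz2010_cor_3_9 F)`. [cite: Raz2010, Cor. 3.9 (p. 163), cf. Cor. 1.6 (p. 145); Defs. 1.1, 1.3] -/
def Raz2010_cor_3_9 : Prop :=
  ringChar F ≠ 2 →
    ∀ (r s : ℕ → ℕ)
      (f : ∀ n : ℕ, Fin (n * Nat.choose (n + r n - 1) (r n)) → MvPolynomial (Fin n) F),
      (∃ n₀ : ℕ, ∀ n ≥ n₀, 1 ≤ r n ∧ r n ≤ n ∧ n ≤ s n) →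
        (∀ c : ℕ, ∃ n₀ : ℕ, ∀ n ≥ n₀, n ^ c ≤ s n) →
          IsPolyDefinableMap (m := fun n => n * Nat.choose (n + r n - 1) (r n))
              (σ := fun n => Fin n) f →
            (∃ n₀ : ℕ, ∀ n ≥ n₀, ∃ (G : Type u) (_ : Field G) (_ : Algebra F G),
                IsElusive (fun i => MvPolynomial.map (algebraMap F G) (f n i)) (s n)
                  (2 * r n - 1)) →
              ¬ IsPComputable (fun N => perPoly (Fin N) F)

/-- **Raz 2010, §1, result 1 (p. 136)**, verbatim: "Let `F` be a field of characteristic not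
equal to `2`. 1. Let `s = s(n)`, `m = m(n)` be such that `n^{ω(1)} ≤ m` (i.e., `m` is
super-polynomial in `n`) and `s ≥ m^{0.9}`. (Think of `m` as relatively small, say
`m = n^{log log n}`.) If there exists an explicit `(s, 2)`-elusive polynomial mapping,
`f : Fⁿ → F^m` (of degree at most poly(`n`)), then any arithmetic circuit for the permanent,
over `F`, is of super-polynomial size." — where (p. 136) "here, and below, explicit means
poly(`n`)-definable, as defined in Definition 1.3". Rendering (cf. the `## Correction` note):
`m s : ℕ → ℕ` are functions of the basic parameter `n` = number of variables = explicitness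
parameter; `n^{ω(1)} ≤ m` is `∀ c, eventually n^c ≤ m n`; `s ≥ m^{0.9}` is `m n ^ 9 ≤ s n ^ 10`
eventually; explicit is `IsPolyDefinableMap` (Def. 1.3, bounds polynomial in `n`, NOT in `m`);
the degree clause is kept verbatim (it also follows from Def. 1.3); elusiveness (Def. 1.1, over
`F` itself as printed here) is asked for all large `n`; "of super-polynomial size" is
`¬ IsPComputable`. This is the form of Cor. 1.14 = Cor. 5.8 (`Raz2010_cor_5_8`, binomial `m`)
that Raz states for general `m`; it is the statement behind the abstract's curve sentence (see
`Raz2010_elusive_curve`). Users take `(h : Raz2010_result_1 F)`.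
[cite: Raz2010, §1, result 1 (p. 136); Defs. 1.1, 1.3] -/
def Raz2010_result_1 : Prop :=
  ringChar F ≠ 2 →
    ∀ (m s : ℕ → ℕ) (f : ∀ n : ℕ, Fin (m n) → MvPolynomial (Fin n) F),
      (∀ c : ℕ, ∃ n₀ : ℕ, ∀ n ≥ n₀, n ^ c ≤ m n) →
        (∃ n₀ : ℕ, ∀ n ≥ n₀, m n ^ 9 ≤ s n ^ 10) →
          IsPolyDefinableMap (m := m) (σ := fun n => Fin n) f →
            IsPBounded (fun n => Finset.univ.sup fun i : Fin (m n) => (f n i).totalDegree) →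
              (∃ n₀ : ℕ, ∀ n ≥ n₀, IsElusive (f n) (s n) 2) →
                ¬ IsPComputable (fun N => perPoly (Fin N) F)

end NamedFacts

/-- Shape of use of `Raz2010_cor_5_8` for `VP`: under its hypotheses the permanent family over
`F` is not a `VP` family (`IsVPFamily = IsPFamily ∧ IsPComputable`). [cite: Raz2010, Cor. 5.8] -/
theorem Raz2010_cor_5_8.not_isVPFamily {F : Type u} [Field F] (h : Raz2010_cor_5_8 F)
    (hF : ringChar F ≠ 2) {r s : ℕ → ℕ}
    {f : ∀ n : ℕ, Fin (Nat.choose (n + r n - 1) (r n)) → MvPolynomial (Fin n) F}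
    (hpar : ∃ n₀ : ℕ, ∀ n ≥ n₀, 3 ≤ r n ∧ r n ≤ n ∧ n ≤ s n)
    (hgrow : ∀ c : ℕ, ∃ n₀ : ℕ, ∀ n ≥ n₀,
      n ^ c * Nat.choose (n + 2 * r n / 3 - 1) (2 * r n / 3) ≤ s n)
    (hexp : IsPolyDefinableMap (m := fun n => Nat.choose (n + r n - 1) (r n))
      (σ := fun n => Fin n) f)
    (hel : ∃ n₀ : ℕ, ∀ n ≥ n₀, ∃ (G : Type u) (_ : Field G) (_ : Algebra F G),
      IsElusive (fun i => MvPolynomial.map (algebraMap F G) (f n i)) (s n) 2) :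
    ¬ IsVPFamily (fun N => perPoly (Fin N) F) :=
  fun hVP => h hF r s f hpar hgrow hexp hel hVP.2

/-- Over the base field itself (`G = F`, e.g. `F = ℂ` as in the abstract) the extension clause
of `Raz2010_cor_5_8` is met by plain elusiveness of `f n`, since mapping along
`algebraMap F F = RingHom.id F` does not change the coordinates. [cite: Raz2010, §1.4] -/
theorem exists_extension_isElusive_of_isElusive {F : Type u} [Field F] {ι : Type*} {n : ℕ}
    {f : ι → MvPolynomial (Fin n) F} {s r : ℕ} (h : IsElusive f s r) :
    ∃ (G : Type u) (_ : Field G) (_ : Algebra F G),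
      IsElusive (fun i => MvPolynomial.map (algebraMap F G) (f i)) s r :=
  ⟨F, inferInstance, inferInstance, by simpa [Algebra.algebraMap_self, MvPolynomial.map_id] using h⟩

/-! ### Multilinearisation (Raz 2010, §1.4, Prop. 1.2) -/

section Multilinearize

variable {k : Type u} [CommSemiring k]

/-- The multilinear monomial `∏_{j < n, bit_j(e) = 1} x_j` encoding the exponent `e` in binary
(Raz 2010, §1.4, before Prop. 1.2: "we replace every occurrence of `x^e` by
`∏_j x_j^{e_j}`, `(e_n, …, e_1)` the binary representation of `e`"), over any commutative
semiring `k`. (Cf. the tree's `bitMonomial r j : MvPolynomial (Fin r) ℤ` of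
`BurgisserTransfer.lean`, the same product written `∏ X_i ^ (bit_i j).toNat` over `ℤ`; the
present semiring-generic copy keeps this file's imports light.) [cite: Raz2010, Prop. 1.2] -/
def multilinMonomial (n e : ℕ) : MvPolynomial (Fin n) k :=
  ∏ j : Fin n, if e.testBit j then X j else 1

/-- **Multilinearisation of a univariate polynomial** (Raz 2010, §1.4, Prop. 1.2, case of one
variable): `f̂ = Σ_e coeff_e(f) · ∏_{j < n, bit_j(e) = 1} x_j ∈ k[x_0, …, x_{n-1}]`, the
multilinear polynomial in `n` new variables obtained from `f ∈ k[x]` by writing each exponent in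
binary. [cite: Raz2010, Prop. 1.2] -/
def multilinearize (n : ℕ) (p : MvPolynomial (Fin 1) k) : MvPolynomial (Fin n) k :=
  ∑ d ∈ p.support, C (coeff d p) * multilinMonomial n (d 0)

/-- Binary expansion of powers: `∏_{j < n, bit_j(e) = 1} a^{2^j} = a^e` for `e < 2^n`. [folklore] -/
theorem prod_ite_testBit_pow_two_pow (a : k) :
    ∀ (n e : ℕ), e < 2 ^ n →
      (∏ j : Fin n, if e.testBit j then a ^ 2 ^ (j : ℕ) else 1) = a ^ e
  | 0, e, he => by
    have : e = 0 := by simpa using he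
    subst this
    simp
  | n + 1, e, he => by
    rw [Fin.prod_univ_succ]
    simp only [Fin.val_zero, pow_zero, pow_one, Fin.val_succ, Nat.testBit_add_one]
    have ih := prod_ite_testBit_pow_two_pow (a ^ 2) n (e / 2)
      (by rw [pow_succ] at he; omega)
    simp_rw [pow_succ' (2 : ℕ), pow_mul]
    rw [ih, ← pow_mul]
    rcases Nat.mod_two_eq_zero_or_one e with h | h
    · have hb : e.testBit 0 = false := Nat.mod_two_eq_zero_iff_testBit_zero.1 h
      rw [hb]
      simp only [Bool.false_eq_true, ↓reduceIte, one_mul]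
      congr 1
      omega
    · have hb : e.testBit 0 = true := Nat.mod_two_eq_one_iff_testBit_zero.1 h
      rw [hb]
      simp only [↓reduceIte]
      rw [← pow_succ']
      congr 1
      omega

/-- Evaluating the bit monomial of `e < 2^n` at `(a^{2^j})_j` gives `a^e`. [folklore] -/
theorem eval_multilinMonomial (a : k) {n e : ℕ} (he : e < 2 ^ n) :
    eval (fun j : Fin n => a ^ 2 ^ (j : ℕ)) (multilinMonomial n e) = a ^ e := by
  unfold multilinMonomial
  rw [map_prod]
  simp_rw [apply_ite (eval _), eval_X, map_one]
  exact prod_ite_testBit_pow_two_pow a n e he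

/-- **Raz 2010, Prop. 1.2** (one variable): if `f ∈ k[x]` has degree `< 2^n` then
`f(a) = f̂(a, a², a⁴, …, a^{2^{n-1}})` for every `a` (here `a = x 0` for a point
`x : Fin 1 → k`). [cite: Raz2010, Prop. 1.2] -/
theorem eval_multilinearize (n : ℕ) (p : MvPolynomial (Fin 1) k) (hp : p.totalDegree < 2 ^ n)
    (x : Fin 1 → k) :
    eval (fun j : Fin n => x 0 ^ 2 ^ (j : ℕ)) (multilinearize n p) = eval x p := by
  unfold multilinearize
  rw [map_sum, eval_eq' x p]
  refine Finset.sum_congr rfl fun d hd => ?_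
  have h1 : d 0 ≤ p.totalDegree := by
    have := le_totalDegree hd
    rwa [show (d.sum fun _ e => e) = d 0 from by
      rw [d.sum_fintype _ (fun _ => rfl), Fin.sum_univ_one]] at this
  rw [map_mul, eval_C, Fin.prod_univ_one, eval_multilinMonomial (x 0) (lt_of_le_of_lt h1 hp)]

/-- **Raz 2010, Prop. 1.2** (one variable): `Image(f) ⊆ Image(f̂)` for a curve
`f = (f_i)_i : k → k^ι` of degree `< 2^n` and its multilinearisation `f̂ : kⁿ → k^ι`.
[cite: Raz2010, Prop. 1.2] -/
theorem range_polyMapEval_subset_multilinearize {ι : Type*} (n : ℕ)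
    (f : ι → MvPolynomial (Fin 1) k) (hf : ∀ i, (f i).totalDegree < 2 ^ n) :
    Set.range (polyMapEval f) ⊆ Set.range (polyMapEval fun i => multilinearize n (f i)) := by
  rintro _ ⟨x, rfl⟩
  exact ⟨fun j => x 0 ^ 2 ^ (j : ℕ), funext fun i => by
    rw [polyMapEval_apply, polyMapEval_apply, eval_multilinearize n (f i) (hf i) x]⟩

/-- **Raz 2010, after Prop. 1.2**: "if `f` eludes a mapping `Γ`, then so does `f̂`. In
particular, if `f` is `(s, r)`-elusive, then so is `f̂`" (one-variable case, degree `< 2^n`).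
[cite: Raz2010, Prop. 1.2] -/
theorem IsElusive.multilinearize {ι : Type*} {n : ℕ} {f : ι → MvPolynomial (Fin 1) k} {s r : ℕ}
    (h : IsElusive f s r) (hf : ∀ i, (f i).totalDegree < 2 ^ n) :
    IsElusive (fun i => multilinearize n (f i)) s r :=
  fun Γ hΓ hsub => h Γ hΓ ((range_polyMapEval_subset_multilinearize n f hf).trans hsub)

/-- The bit monomial has total degree `≤ n` (it is multilinear in `n` variables). [folklore] -/
theorem totalDegree_multilinMonomial_le (n e : ℕ) :
    (multilinMonomial (k := k) n e).totalDegree ≤ n := by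
  unfold multilinMonomial
  refine (totalDegree_finsetProd _ _).trans ?_
  calc ∑ j : Fin n, (if e.testBit j then (X j : MvPolynomial (Fin n) k) else 1).totalDegree
      ≤ ∑ _j : Fin n, 1 := Finset.sum_le_sum fun j _ => by
        split_ifs
        · exact (totalDegree_monomial_le _ _).trans (by simp)
        · simp
    _ = n := by simp

/-- The multilinearisation has total degree `≤ n`. [cite: Raz2010, Prop. 1.2] -/
theorem totalDegree_multilinearize_le (n : ℕ) (p : MvPolynomial (Fin 1) k) :
    (multilinearize n p).totalDegree ≤ n := by
  unfold multilinearize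
  refine (totalDegree_finsetSum _ _).trans (Finset.sup_le fun d _ => ?_)
  exact (totalDegree_mul _ _).trans
    (by simpa using totalDegree_multilinMonomial_le (k := k) n (d 0))

end Multilinearize

/-! ### The abstract's curve statement, with Raz's explicitness -/

/-- **The abstract's curve statement, corrected form of `raz_elusive_curve`** (Raz 2010,
abstract: "any explicit `f : ℂ → ℂ^m` [not contained in the image of any polynomial mapping
`Γ : ℂ^{m-1} → ℂ^m` of degree `2`] (with the right notion of explicitness), of degree up to
`2^{m^{o(1)}}`, implies super-polynomial lower bounds for computing the permanent over `ℂ`"),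
with "the right notion of explicitness" spelled out as on pp. 136–137 and §1.4–1.5: the curves
are indexed by Raz's basic parameter `n` with `m = m(n) ≥ n^{ω(1)}` (equivalently
`n = m^{o(1)}`), have degree `< 2ⁿ` (`= 2^{m^{o(1)}}`), and EXPLICIT means that the
multilinearisation `f̂ n : Fⁿ → F^{m(n)}` of Prop. 1.2 (`multilinearize n ∘ f n`, `n` new
variables for the `n` bits of the exponent) is poly(`n`)-definable (Def. 1.3) — p. 137: "an
elusive polynomial mapping of degree up to `2ⁿ` (rather than poly(`n`)) is also sufficient, since
we can easily construct from it a multilinear polynomial mapping `f̂` such that the image of `f`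
is contained in the image of `f̂`"; conclusion over any `F` of characteristic `≠ 2` (abstract:
`F = ℂ`): the permanent family is not p-computable. Discrepancy with `raz_elusive_curve`: there
the explicitness index is the arity `m` itself, which makes Def. 1.3 vacuous (see the
`## Correction` note); here it is `n = m^{o(1)}` as in print. This `Prop` is PROVED from
`Raz2010_result_1` (`Raz2010_elusive_curve_of_result_1`, with `s = m - 1 ≥ m^{0.9}`); it is
not itself a numbered statement of the paper. `m n - 1` is a junk value only when `m n = 0`,
which the growth condition excludes for large `n`.
[cite: Raz2010, abstract and §1 result 1 (p. 136), Prop. 1.2, Def. 1.3] -/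
def Raz2010_elusive_curve (F : Type u) [Field F] : Prop :=
  ringChar F ≠ 2 →
    ∀ (m : ℕ → ℕ) (f : ∀ n : ℕ, Fin (m n) → MvPolynomial (Fin 1) F),
      (∀ c : ℕ, ∃ n₀ : ℕ, ∀ n ≥ n₀, n ^ c ≤ m n) →
        (∃ n₀ : ℕ, ∀ n ≥ n₀, ∀ i : Fin (m n), (f n i).totalDegree < 2 ^ n) →
          IsPolyDefinableMap (m := m) (σ := fun n => Fin n)
              (fun n i => multilinearize n (f n i)) →
            (∃ n₀ : ℕ, ∀ n ≥ n₀, IsElusive (f n) (m n - 1) 2) →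
              ¬ IsPComputable (fun N => perPoly (Fin N) F)

/-- `M^9 ≤ (M - 1)^{10}` for `M ≥ 1024` (so `s = m - 1 ≥ m^{0.9}` for large `m`). [folklore] -/
theorem pow_nine_le_pred_pow_ten {M : ℕ} (hM : 1024 ≤ M) : M ^ 9 ≤ (M - 1) ^ 10 := by
  have h1 : M ≤ 2 * (M - 1) := by omega
  have h2 : M ^ 10 ≤ 2 ^ 10 * (M - 1) ^ 10 := by
    calc M ^ 10 ≤ (2 * (M - 1)) ^ 10 := Nat.pow_le_pow_left h1 10
      _ = 2 ^ 10 * (M - 1) ^ 10 := mul_pow 2 (M - 1) 10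
  have h3 : 2 ^ 10 * M ^ 9 ≤ M ^ 10 := by
    calc 2 ^ 10 * M ^ 9 ≤ M * M ^ 9 := Nat.mul_le_mul_right _ hM
      _ = M ^ 10 := by ring
  exact Nat.le_of_mul_le_mul_left (h3.trans h2) (by norm_num)

/-- **`Raz2010_result_1` ⇒ `Raz2010_elusive_curve`**: the abstract's curve statement follows
from §1 result 1 applied to the multilinearised curve `f̂ n : Fⁿ → F^{m(n)}` (Prop. 1.2:
`Image f ⊆ Image f̂`, so `f̂` inherits `(m-1, 2)`-elusiveness; `deg f̂ ≤ n`; and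
`s = m - 1 ≥ m^{0.9}` once `m ≥ 1024`). [cite: Raz2010, §1 (pp. 136–137), Prop. 1.2] -/
theorem Raz2010_elusive_curve_of_result_1 {F : Type u} [Field F] (h : Raz2010_result_1 F) :
    Raz2010_elusive_curve F := by
  intro hF m f hm hdeg hexp hel
  refine h hF m (fun n => m n - 1) (fun n i => multilinearize n (f n i)) hm ?_ hexp ?_ ?_
  · obtain ⟨n₁, hn₁⟩ := hm 1
    refine ⟨max n₁ 1024, fun n hn => pow_nine_le_pred_pow_ten ?_⟩
    have := hn₁ n ((le_max_left _ _).trans hn)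
    rw [pow_one] at this
    exact ((le_max_right _ _).trans hn).trans this
  · exact IsPBounded.id.mono fun n =>
      Finset.sup_le fun i _ => totalDegree_multilinearize_le n (f n i)
  · obtain ⟨n₀, h₀⟩ := hel
    obtain ⟨n₂, h₂⟩ := hdeg
    exact ⟨max n₀ n₂, fun n hn =>
      (h₀ n ((le_max_left _ _).trans hn)).multilinearize (h₂ n ((le_max_right _ _).trans hn))⟩

/-- Over `ℂ` (the abstract's field; `ringChar ℂ = 0 ≠ 2`) and in the `VP` vocabulary of
`raz_elusive_curve`: an explicit (multilinearisation poly(`n`)-definable), degree `< 2ⁿ`,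
eventually `(m-1, 2)`-elusive curve family `f n : ℂ → ℂ^{m(n)}` with `m ≥ n^{ω(1)}` refutes
`VP`-membership of the permanent family over `ℂ`. [cite: Raz2010, abstract] -/
theorem Raz2010_elusive_curve.not_isVPFamily_complex (h : Raz2010_elusive_curve ℂ)
    {m : ℕ → ℕ} {f : ∀ n : ℕ, Fin (m n) → MvPolynomial (Fin 1) ℂ}
    (hm : ∀ c : ℕ, ∃ n₀ : ℕ, ∀ n ≥ n₀, n ^ c ≤ m n)
    (hdeg : ∃ n₀ : ℕ, ∀ n ≥ n₀, ∀ i : Fin (m n), (f n i).totalDegree < 2 ^ n)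
    (hexp : IsPolyDefinableMap (m := m) (σ := fun n => Fin n)
      (fun n i => multilinearize n (f n i)))
    (hel : ∃ n₀ : ℕ, ∀ n ≥ n₀, IsElusive (f n) (m n - 1) 2) :
    ¬ IsVPFamily (fun N => perPoly (Fin N) ℂ) :=
  fun hVP => h (by rw [ringChar.eq_zero]; decide) m f hm hdeg hexp hel hVP.2

/-! ### Deprecated: the original rendering `raz_elusive_curve` (misstated; clean-up 2026-08-15)

Kept byte-for-byte (statement unchanged) under `@[deprecated Raz2010_elusive_curve]`, only
because `raz_elusive_curve_iff` (`RazElusiveGeneralProofs.lean`) and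
`raz_elusive_curve_iff_not_isVPFamily`, `raz_elusive_curve_iff_perNotPComputableComplex`
(`RazElusiveGeneralExistence.lean`) — the theorems certifying the misstatement — name it. See
the module docstring, `## Deprecation`. Do not use: a hypothesis `(h : raz_elusive_curve)` is
literally an assumption of the open statement `PerNotPComputableComplex` (pnp.S04). -/

/-- **DEPRECATED (2026-08-15) — misstated; use `Raz2010_elusive_curve`** (same file, discharged
as `Raz2010_elusive_curve_holds` in `RazElusiveGeneralDischarge.lean`; printed theorems:
`Raz2010_cor_5_8`, `Raz2010_cor_3_9`, `Raz2010_result_1`). WHAT IS WRONG: this rendering of the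
abstract's curve sentence indexes Raz's poly(`n`)-definability (Def. 1.3) by the OUTPUT ARITY
`m` (`IsPolyDefinableMap (m := id) (σ := fun _ => Fin 1)`: the defining polynomial `g_m` may
have poly(`m`) degree and circuit size), whereas Raz (remark after Def. 1.3, p. 142) allows the
circuit for `g` "to depend polynomially on `n`, but … not … polynomially on `m`", the abstract's
explicitness parameter being `n = m^{o(1)}` (§1, p. 136, result 1). With index `m` the
explicitness clause follows from the degree clause (`raz_elusive_curve_iff`,
`RazElusiveGeneralProofs.lean`), so this `Prop` only says "if SOME polynomial-degree curve
family is eventually `(m-1, 2)`-elusive then `PER ∉ VP_ℂ`", and since such families exist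
non-explicitly it is EQUIVALENT to `¬ IsVPFamily (PER_ℂ)` and to the registered open statement
`PerNotPComputableComplex`, pnp.S04 (`raz_elusive_curve_iff_not_isVPFamily`,
`raz_elusive_curve_iff_perNotPComputableComplex`, `RazElusiveGeneralExistence.lean`): it is not
a theorem in print and can be neither discharged nor refuted short of settling Valiant's
hypothesis over `ℂ`. Original description (kept for the record): "if some family of curves
`f m : ℂ → ℂ^m` (coordinates `f m i ∈ ℂ[x]`, one variable `Fin 1`) is explicit in Raz's sense
(`IsPolyDefinableMap`, Def. 1.3), has degree polynomially bounded in `m`, and is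
`(m-1, 2)`-elusive (`IsElusive (f m) (m-1) 2`, Def. 1.1) for all sufficiently large `m`, then
the permanent family over `ℂ` is not p-computable (`¬ IsVPFamily`)." Statement unchanged; kept
rather than deleted by the human ruling of 2026-08-15 on misstated facts, because the three
theorems above name it.
[cite: Raz2010, abstract and §1 result 1 (p. 136) — misrendered explicitness index (Def. 1.3 and the remark after it, p. 142), see the deprecation note; corrected as Raz2010_elusive_curve] -/
@[deprecated Raz2010_elusive_curve "misstated: Def. 1.3 (poly(n)-definability) is indexed here \
by the arity m, which voids the explicitness clause (raz_elusive_curve_iff) and makes this Prop \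
equivalent to the open statement PerNotPComputableComplex \
(raz_elusive_curve_iff_perNotPComputableComplex); use Raz2010_elusive_curve (discharged: \
Raz2010_elusive_curve_holds, RazElusiveGeneralDischarge.lean)" (since := "2026-08-15")]
def raz_elusive_curve : Prop :=
  ∀ f : ∀ m : ℕ, Fin m → MvPolynomial (Fin 1) ℂ,
    IsPolyDefinableMap (m := id) (σ := fun _ => Fin 1) f →
      IsPBounded (fun m => Finset.univ.sup fun i : Fin m => (f m i).totalDegree) →
        (∃ m₀ : ℕ, ∀ m ≥ m₀, IsElusive (f m) (m - 1) 2) →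
          ¬ IsVPFamily (fun n => perPoly (Fin n) ℂ)

end Literature.Computability.AlgebraicComplexity
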